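/-
Copyright (c) 2026 the pub-hodgecm-mathlib formalisation cell (harness21).  Prover seat hodgecm-mathlib-LH4-p19 (g2), req620 Track A «(D-RAM) FOUR-FRAME» squad
(STAGE-1b, row (2) of the piece `f_{T₊}`, the (β₂) road (R-36) «PURE-CELL LEDGER»; β₂ sub-dealer LH4-p04 lineage, lane B (RamK), row (L-D♭) «the diagonal cell below the
clean line»; heir LEAD F0P3a-plan (g21) T20-19 «RELATIVE SIGNS, NEVER σ(u)»), 2026-09-04.
-/
import Summits.HodgeConjecture.HodgeConjecture.Theorems.F0P3cDyRamDiagonalCellLetter        -- ★ p861637+p861725 (LH4-p19 (g0)) §1 helpers (`v_add_map_le_of_le`), ★ DEFS `IsOrd ∕ dualGen`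
import Summits.HodgeConjecture.HodgeConjecture.Theorems.F0P3cDyRamDiagonalCellCleanRegime   -- ★ p861813 (LH4-p19 (g0)) §1 `exists_fixed_unit_sub_mul_refSkew_le`, §4 `v_map_le_pow_iff`, `v_eq_pow_of_map_eq`, `exists_eq_pow_mul_map_add`; brings ★ `d_le_succ_t`
import HarnessLib

/-!
# Crux `H413`, line LH4 «(D-RAM) FOUR-FRAME» — STAGE-1b, row (2), the (β₂) road (R-36), lane B, row (L-D♭): «THE SCALAR OF THE DIAGONAL CELL IS A UNIT OF DEEP TRACE» —
# the vertex-dependent letter scalar `s_Λ = jE⁻¹Tr_ρ(μ∕D₀(Λ))` of the sibling `F0P3cDyRamDiagonalCellLetterBalanced` is a UNIT for every eigenvalue gap `δ ≥ 1`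
# (Gram-primitivity), has `|s_Λ + σs_Λ| ≤ |ϖ|^{3d−2}` (torus equations, `2b ≥ 3d − 2`), hence `s_Λ ≡ f_Λ·t₊ (mod 𝔭^{m*})` with `f_Λ` a `σ`-FIXED UNIT (`d` even)

Cell `hodgecm-mathlib` (D-0151), FLOOR 0, crux item H413 = `stmt-HodgeConjecture-24833`, route of record `HCCMUnconditional`; squad F0∕P3c∕LH4; lane
`--supports stmt-HodgeConjecture-24833 --as helper` (count-neutral; pays NO tier-0 row).  THEOREMS ONLY (no `def`, no instance, no notation, no `sorry`, default heartbeats);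
★-only imports; states NO law; (β₂) stays a HYPOTHESIS.  DATUM-FREE one-field letters (`M` with `ρ`, `Θ`, `α`, `jE : E → M`; ★ DEFS `IsOrd ∕ dualGen`); the sheet datum
`IsRamifiedQuadraticDatum σ ϖ d t` on `E` only in §3; no lattice, no residue field.

WHY (memo `F0/P3c/LH4/LH4-p19/g0/MECH-LDflat.v1.LH4p19g0.md` 8f57960d §1).  The sibling HEAD (`valueSet_endoGL_sub_one_glued_eq_scalar_normSet_of_diag`) reads the letter of a
glued vertex over `Λ = x₀·𝒪_b ∈ D` as `{s_Λ·N(a)} + 𝔭^m` with `jE s_Λ = Tr_ρ(μ∕D₀)`, `μ = lam − jE u₀₀`, `D₀ = cc(α − ρα)·ΘY = ccΘcc·(α − ρα)Θ(α − ρα)·h_M·N_Θ(x₀)`.  To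
turn this into a LABEL (★ p861154: `VS_{m*}(f • X₊) = VS_{m*}(X₊) ↔ f ∈ N(E^×)` for `σ`-fixed units `f`) one needs `s_Λ ≡ f_Λ·t₊ (mod 𝔭^{m*})`, which ★ p861813 §1 supplies
for a UNIT `s_Λ` with DEEP TRACE `|s_Λ + σs_Λ| ≤ |ϖ|^{3d−2}`.  THIS FILE proves both letters below the clean line:
* §1 DEEP TRACE (`sub_add_map_sub_eq_of_torus`, `v_scalarTrace_add_map_le_of_torus`, `v_scalar_add_map_le_of_torus`): `Θμ = −μ∕(lam·jE u₀₀)` from the torus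
  equations, so `|μ + Θμ| ≤ |μ|·max(|μ|, |ϖ|^{m*+d−1})` (`|u₀₀ − 1| ≤ |ϖ|^{m*}`, `|2| ≤ |ϖ|^{d−1}`); with `ΘD₀ = D₀`, `|D₀| = |jEϖ|^{2b} ≥ |μ|`, `3d − 2 ≤ 2b`: `|s_Λ + σs_Λ| ≤ |ϖ|^{3d−2}`.
* §2 UNIT (`v_add_map_eq_one_of_not_isOrd_div`: Gram-primitivity ⟺ `|κ + ρκ| = 1`, `κ = h_M·N_Θ(x₀)`; `normTheta_sub_map_eq_sq_add`: `(α − ρα)Θ(α − ρα) ≡ (α − ρα)²`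
  modulo `𝔭_M` by the RamK case-definer `|α − Θα| < 1`; HEAD `v_scalarTrace_eq_one_of_gap`): `|Tr_ρ(μ∕D₀)| = 1` for `δ ≥ 1` (★ p861813 §4: `μ = ϖE^{2b}(jE e + ϖE^δ y)`,
  leading term `(ϖE^{2b}∕ccΘcc)·jE e·Tr_ρ((ν₁κ)⁻¹)`, a unit).  At `δ = 0` this FAILS ((L-EQ): off-shell vertices on `D`).
* §3 HEAD′ `exists_scalar_fixed_unit_of_diag_of_gap` — assembled: `∃ s f`, `jE s = Tr_ρ(μ∕D₀)`, `|s| = 1`, `|s + σs| ≤ |ϖ|^{3d−2}`, `σf = f`, `|f| = 1`, `|s − f·t₊| ≤ |ϖ|^{m*}`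
  (`d` even, `1 ≤ δ`, `3d − 2 ≤ 2b`) — the `(s, f)` the sibling HEAD′ consumes; by ★ p861154 the vertex carries label `+` iff `f ∈ N(E^×)`.
WHAT IS NOT CLAIMED: the COUNT (norm class of `f_Λ` balanced on the populated part of `D`, `2 ≤ δ ≤ 2d − 2`), shell conditions, the glued dictionary, anything at `δ = 0`.
HONEST LABEL.  Count-neutral local algebra; nothing printed is asserted; no census law is stated; `HC_CM` is proved only modulo the 7 printed citations (2 remaining named inputs:
hLiu418 = `stmt-HodgeConjecture-24832`, h413 = `stmt-HodgeConjecture-24833`) until rung 0 closes.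
## References
* [Jacobowitz1962] R. Jacobowitz, *Hermitian forms over local fields*, Amer. J. Math. 84 (1962): §4 (dual lattices, modular components, gluing).
* [Serre1979] J.-P. Serre, *Local Fields*, GTM 67 (1979): Ch. I §6 Prop. 18, Ch. III §3 Prop. 7 (trace ideals), Ch. III §6 Prop. 12 (orders), Ch. V §3 Cor. 3 (norm classes of units).
* [Rogawski1990] J. D. Rogawski, *Automorphic Representations of Unitary Groups in Three Variables*, Ann. of Math. Stud. 123 (1990): §4.9 Prop. 4.9.1 (b) p. 55, §12.2.
* [Kottwitz1986BaseChangeUnits] R. E. Kottwitz, *Base change for unit elements of Hecke algebras*, Compositio Math. 60 (1986): §1 pp. 240–241.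
* [LanglandsShelstad1987] R. P. Langlands, D. Shelstad, *On the definition of transfer factors*, Math. Ann. 278 (1987): §1–§3 (κ-signs on a stable class).
-/

set_option autoImplicit false

noncomputable section

namespace Summit.HodgeConjecture.HodgeConjecture.Cruxes.H413.F0P3cDyRamDiagonalCellScalarUnit

open scoped Valued WithZero
open WithZero
open Literature.NumberTheory.Automorphic.UnitaryThreeFourFrame (IsRamifiedQuadraticDatum)
open Literature.NumberTheory.LocalFields.WildQuadraticDatum (d_le_succ_t v_eq_one_of_v_mul_map_eq_one)
open Summit.HodgeConjecture.HodgeConjecture.Cruxes.H413.F0P3cDyRamToricCensusDefs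
open Summit.HodgeConjecture.HodgeConjecture.Cruxes.H413.F0P3cDyRamFourFramePieces (mstarOfRecord)
open Summit.HodgeConjecture.HodgeConjecture.Cruxes.H413.F0P3cDyRamDiagonalCellLetter (v_add_map_le_of_le)
open Summit.HodgeConjecture.HodgeConjecture.Cruxes.H413.F0P3cDyRamDiagonalCellCleanRegime (exists_fixed_unit_sub_mul_refSkew_le v_map_le_pow_iff v_eq_pow_of_map_eq
  exists_eq_pow_mul_map_add v_varpi_pow_le_pow)

/-! ## §1 The scalar has DEEP TRACE: `|Tr_ρ(μ∕D₀) + Θ Tr_ρ(μ∕D₀)| ≤ |jEϖ|^{3d−2}` from the torus equations -/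

section Trace

variable {E M : Type} [Field E] [Valued E ℤᵐ⁰] [Field M] [Valued M ℤᵐ⁰] {ρ Θ : M →+* M}

omit [Valued E ℤᵐ⁰] [Valued M ℤᵐ⁰] in
/-- **`Θμ = −μ∕(lam·jE u)`**: with `Θ(lam)·lam = 1` and `u·σu = 1` (`Θ ∘ jE = jE ∘ σ`), `μ = lam − jE u` has `μ + Θμ = μ·(μ·jE u + (jE u·jE u − 1))∕(lam·jE u)`.
[cite: Jacobowitz1962, §4] -/
theorem sub_add_map_sub_eq_of_torus (σ : E →+* E) (jE : E →+* M) (hΘj : ∀ c, Θ (jE c) = jE (σ c))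
    {lam : M} (hΘlam : Θ lam * lam = 1) {u : E} (huu : u * σ u = 1) :
    (lam - jE u) + Θ (lam - jE u) = (lam - jE u) * ((lam - jE u) * jE u + (jE u * jE u - 1)) / (lam * jE u) := by
  have hlam0 : lam ≠ 0 := fun h0 => by rw [h0, mul_zero] at hΘlam; exact zero_ne_one hΘlam
  have hu0 : u ≠ 0 := fun h0 => by rw [h0, zero_mul] at huu; exact zero_ne_one huu
  have hju0 : jE u ≠ 0 := (map_ne_zero jE).2 hu0
  have hΘlam' : Θ lam = lam⁻¹ := eq_inv_of_mul_eq_one_left hΘlam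
  have hσu : σ u = u⁻¹ := eq_inv_of_mul_eq_one_right huu
  rw [map_sub, hΘj, hΘlam', hσu, map_inv₀]
  field_simp
  ring

/-- **THE SCALAR HAS DEEP TRACE (M-side).**  Letters: `Θ` an involution commuting with `ρ`, both isometric, `Θ ∘ jE = jE ∘ σ`, `|jE c| ≤ 1 ↔ |c| ≤ 1`; the torus equations
`Θ(lam)·lam = 1`, `|lam| = 1`, `u·σu = 1`; the frame letter `|u − 1| ≤ |ϖ|^{m*}` (`m* = mstarOfRecord d`) and the wild letter `|2| ≤ |ϖ|^{d−1}` (a ramified datum has `d ≤ t + 1`);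
`D₀` with `ΘD₀ = D₀`, `|D₀| = |jEϖ|^{2b}`; the depth `|μ| ≤ |jEϖ|^{2b}` (`μ = lam − jE u`) and the regime `3d − 2 ≤ 2b`.  THEN `S := μ∕D₀ + ρ(μ∕D₀)` has `|S + ΘS| ≤ |jEϖ|^{3d−2}`:
`S + ΘS = Tr_ρ((μ + Θμ)∕D₀)` and `|μ + Θμ| = |μ|·|μ·jE u + (jE u² − 1)| ≤ |μ|·max(|μ|, |ϖ|^{m*+d−1})`. [cite: Serre1979, Ch. III §3 Prop. 7] [cite: Jacobowitz1962, §4] -/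
theorem v_scalarTrace_add_map_le_of_torus (σ : E →+* E) (hvσ : ∀ a, Valued.v (σ a) = Valued.v a) {ϖ : E} (hϖ : Valued.v ϖ = exp (-1 : ℤ)) {d : ℕ}
    (jE : E →+* M) (hjv : ∀ c, Valued.v (jE c) ≤ 1 ↔ Valued.v c ≤ 1) (hvρ : ∀ x, Valued.v (ρ x) = Valued.v x)
    (hΘρ : ∀ x, Θ (ρ x) = ρ (Θ x)) (hvΘ : ∀ x, Valued.v (Θ x) = Valued.v x) (hΘj : ∀ c, Θ (jE c) = jE (σ c))
    (h2 : Valued.v (2 : E) ≤ Valued.v ϖ ^ (d - 1))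
    {lam : M} (hΘlam : Θ lam * lam = 1) (hlam1 : Valued.v lam = 1)
    {u : E} (huu : u * σ u = 1) (hu1 : Valued.v (u - 1) ≤ Valued.v ϖ ^ mstarOfRecord d)
    {D₀ : M} {b : ℕ} (hΘD₀ : Θ D₀ = D₀) (hD₀ : Valued.v D₀ = Valued.v (jE ϖ) ^ (2 * b)) (hD₀0 : D₀ ≠ 0)
    (hμv : Valued.v (lam - jE u) ≤ Valued.v (jE ϖ) ^ (2 * b)) (hb : 3 * d - 2 ≤ 2 * b) :
    Valued.v ((lam - jE u) / D₀ + ρ ((lam - jE u) / D₀) + Θ ((lam - jE u) / D₀ + ρ ((lam - jE u) / D₀))) ≤ Valued.v (jE ϖ) ^ (3 * d - 2) := by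
  have hvϖ0 : Valued.v ϖ ≠ 0 := by rw [hϖ]; exact exp_ne_zero
  have hϖ0 : ϖ ≠ 0 := fun h0 => by rw [h0, map_zero] at hvϖ0; exact hvϖ0 rfl
  have hϖ1 : Valued.v ϖ ≤ 1 := by rw [hϖ, ← exp_zero, exp_le_exp]; norm_num
  have hπ1 : Valued.v (jE ϖ) ≤ 1 := (hjv ϖ).2 hϖ1
  have hD₀v0 : Valued.v D₀ ≠ 0 := (Valuation.ne_zero_iff _).2 hD₀0
  have hlam0 : lam ≠ 0 := fun h0 => by rw [h0, mul_zero] at hΘlam; exact zero_ne_one hΘlam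
  have hu0 : u ≠ 0 := fun h0 => by rw [h0, zero_mul] at huu; exact zero_ne_one huu
  have hju0 : jE u ≠ 0 := (map_ne_zero jE).2 hu0
  -- `|u| = 1` and `|jE u| = 1` from `u·σu = 1`
  have hvu : Valued.v u = 1 := v_eq_one_of_v_mul_map_eq_one hvσ (by rw [huu, Valuation.map_one])
  have hvju : Valued.v (jE u) = 1 :=
    v_eq_one_of_v_mul_map_eq_one (σ := Θ) hvΘ (by rw [hΘj, ← map_mul, huu, map_one, Valuation.map_one])
  -- `|jE(u² − 1)| ≤ |jE ϖ|^{m* + (d − 1)}`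
  have hmstar : d - 1 ≤ mstarOfRecord d := by simp only [mstarOfRecord]; omega
  have hu21 : Valued.v (jE u * jE u - 1) ≤ Valued.v (jE ϖ) ^ (mstarOfRecord d + (d - 1)) := by
    have hfac : jE u * jE u - 1 = jE ((u - 1) * ((u - 1) + 2)) := by rw [map_mul, map_add, map_sub, map_one, map_ofNat]; ring
    rw [hfac]
    refine (v_map_le_pow_iff jE hjv hϖ0 _ _).2 ?_
    rw [Valuation.map_mul, pow_add]
    refine mul_le_mul' hu1 ((Valuation.map_add _ _ _).trans (max_le (hu1.trans (v_varpi_pow_le_pow hϖ hmstar)) h2))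
  -- `|μ + Θμ| ≤ |μ| · max`
  set μ : M := lam - jE u with hμdef
  have hsum : μ + Θ μ = μ * (μ * jE u + (jE u * jE u - 1)) / (lam * jE u) := sub_add_map_sub_eq_of_torus σ jE hΘj hΘlam huu
  have hvtr : Valued.v (μ + Θ μ) ≤ Valued.v (jE ϖ) ^ (2 * b) * Valued.v (jE ϖ) ^ (3 * d - 2) := by
    rw [hsum, map_div₀, Valuation.map_mul, Valuation.map_mul, hlam1, hvju, one_mul, div_one]
    refine mul_le_mul' hμv ((Valuation.map_add _ _ _).trans (max_le ?_ ?_))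
    · rw [Valuation.map_mul, hvju, mul_one]; exact hμv.trans (pow_le_pow_right_of_le_one' hπ1 hb)
    · refine hu21.trans (pow_le_pow_right_of_le_one' hπ1 ?_)
      simp only [mstarOfRecord]; omega
  -- `S + ΘS = Tr_ρ((μ + Θμ)/D₀)`
  have hΘ1 : Θ (μ / D₀) = Θ μ / D₀ := by rw [map_div₀, hΘD₀]
  have hΘ2 : Θ (ρ (μ / D₀)) = ρ (Θ μ / D₀) := by rw [hΘρ, hΘ1]
  have hS : μ / D₀ + ρ (μ / D₀) + Θ (μ / D₀ + ρ (μ / D₀)) = (μ + Θ μ) / D₀ + ρ ((μ + Θ μ) / D₀) := by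
    rw [map_add Θ, hΘ1, hΘ2, add_div, map_add ρ (μ / D₀)]
    ring
  rw [hS]
  refine v_add_map_le_of_le ρ hvρ ?_
  rw [map_div₀, hD₀, div_le_iff₀ (zero_lt_iff.2 (by rw [hD₀] at hD₀v0; exact hD₀v0)), mul_comm]
  exact hvtr

/-- **THE SCALAR HAS DEEP TRACE (E-side transport)**: under `v_scalarTrace_add_map_le_of_torus`'s letters, every `s : E` with `jE s = μ∕D₀ + ρ(μ∕D₀)` has
`|s + σ s| ≤ |ϖ|^{3d−2}` (`jE(s + σs) = S + ΘS` by `Θ ∘ jE = jE ∘ σ`; ★ `v_map_le_pow_iff`). [cite: Serre1979, Ch. III §3 Prop. 7] -/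
theorem v_scalar_add_map_le_of_torus (σ : E →+* E) (hvσ : ∀ a, Valued.v (σ a) = Valued.v a) {ϖ : E} (hϖ : Valued.v ϖ = exp (-1 : ℤ)) {d : ℕ}
    (jE : E →+* M) (hjv : ∀ c, Valued.v (jE c) ≤ 1 ↔ Valued.v c ≤ 1) (hvρ : ∀ x, Valued.v (ρ x) = Valued.v x)
    (hΘρ : ∀ x, Θ (ρ x) = ρ (Θ x)) (hvΘ : ∀ x, Valued.v (Θ x) = Valued.v x) (hΘj : ∀ c, Θ (jE c) = jE (σ c))
    (h2 : Valued.v (2 : E) ≤ Valued.v ϖ ^ (d - 1))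
    {lam : M} (hΘlam : Θ lam * lam = 1) (hlam1 : Valued.v lam = 1)
    {u : E} (huu : u * σ u = 1) (hu1 : Valued.v (u - 1) ≤ Valued.v ϖ ^ mstarOfRecord d)
    {D₀ : M} {b : ℕ} (hΘD₀ : Θ D₀ = D₀) (hD₀ : Valued.v D₀ = Valued.v (jE ϖ) ^ (2 * b)) (hD₀0 : D₀ ≠ 0)
    (hμv : Valued.v (lam - jE u) ≤ Valued.v (jE ϖ) ^ (2 * b)) (hb : 3 * d - 2 ≤ 2 * b)
    {s : E} (hs : jE s = (lam - jE u) / D₀ + ρ ((lam - jE u) / D₀)) :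
    Valued.v (s + σ s) ≤ Valued.v ϖ ^ (3 * d - 2) := by
  have hvϖ0 : Valued.v ϖ ≠ 0 := by rw [hϖ]; exact exp_ne_zero
  have hϖ0 : ϖ ≠ 0 := fun h0 => by rw [h0, map_zero] at hvϖ0; exact hvϖ0 rfl
  refine (v_map_le_pow_iff jE hjv hϖ0 _ _).1 ?_
  rw [map_add, ← hΘj, hs]
  exact v_scalarTrace_add_map_le_of_torus σ hvσ hϖ jE hjv hvρ hΘρ hvΘ hΘj h2 hΘlam hlam1 huu hu1 hΘD₀ hD₀ hD₀0 hμv hb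

end Trace

/-! ## §2 The scalar is a UNIT as soon as the eigenvalue gap is positive (`δ ≥ 1`) -/

section Unit

variable {M : Type} [Field M] [Valued M ℤᵐ⁰] {ρ Θ : M →+* M} {α : M}

/-- **A value strictly between `exp(−1)` and `1` does not exist**: `|z| ≤ 1`, `exp(−1) < |z|` ⇒ `|z| = 1` (values in `ℤᵐ⁰`). [cite: Serre1979, Ch. III §6 Prop. 12] -/
theorem v_eq_one_of_exp_neg_one_lt {z : M} (hz1 : Valued.v z ≤ 1) (hlt : exp (-1 : ℤ) < Valued.v z) : Valued.v z = 1 := by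
  have hz0 : Valued.v z ≠ 0 := ne_of_gt (lt_of_le_of_lt zero_le hlt)
  obtain ⟨n, hn⟩ : ∃ n : ℤ, Valued.v z = exp n := ⟨log (Valued.v z), (exp_log hz0).symm⟩
  rw [hn] at hz1 hlt ⊢
  rw [← exp_zero, exp_le_exp] at hz1
  rw [exp_lt_exp] at hlt
  rw [← exp_zero]
  congr 1
  omega

/-- **GRAM-PRIMITIVITY READS `|κ + ρκ| = 1`.**  For `Y = κ·cc·(α − ρα)` with `ρcc = cc`, `ρϖE = ϖE`, `ρ` an isometric involution, `|κ| ≤ 1`, `cc(α − ρα) ≠ 0`,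
`|ϖE| = exp(−1)`: if `Y∕ϖE` is NOT in the order of conductor `cc` (`¬ IsOrd ρ α cc (Y∕ϖE)`, the Gram-primitivity clause of ★ DEFS `levelSet`) while `|Y∕ϖE| ≤ 1` (`b ≥ 1`),
then `|κ + ρκ| = 1` (`Y∕ϖE − ρ(Y∕ϖE) = (κ + ρκ)·cc(α − ρα)∕ϖE`). [cite: Jacobowitz1962, §4] [cite: Serre1979, Ch. III §6 Prop. 12] -/
theorem v_add_map_eq_one_of_not_isOrd_div (hρρ : ∀ x, ρ (ρ x) = x) (hvρ : ∀ x, Valued.v (ρ x) = Valued.v x)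
    {cc κ ϖE : M} (hρcc : ρ cc = cc) (hρϖ : ρ ϖE = ϖE) (hcc : cc * (α - ρ α) ≠ 0) (hκ1 : Valued.v κ ≤ 1)
    (hϖE : Valued.v ϖE = exp (-1 : ℤ)) (hY1 : Valued.v (κ * (cc * (α - ρ α)) / ϖE) ≤ 1)
    (hnot : ¬ IsOrd ρ α cc (κ * (cc * (α - ρ α)) / ϖE)) : Valued.v (κ + ρ κ) = 1 := by
  have hvϖ0 : Valued.v ϖE ≠ 0 := by rw [hϖE]; exact exp_ne_zero
  have hvcc : (0 : ℤᵐ⁰) < Valued.v (cc * (α - ρ α)) := zero_lt_iff.2 ((Valuation.ne_zero_iff _).2 hcc)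
  rw [isOrd_iff, not_and, not_le] at hnot
  have hlt := hnot hY1
  have hdiff : κ * (cc * (α - ρ α)) / ϖE - ρ (κ * (cc * (α - ρ α)) / ϖE) = (κ + ρ κ) * (cc * (α - ρ α)) / ϖE := by
    rw [map_div₀, map_mul, map_mul, hρcc, map_sub, hρρ, hρϖ]; ring
  have hκρ1 : Valued.v (κ + ρ κ) ≤ 1 := v_add_map_le_of_le ρ hvρ hκ1
  by_contra hne
  have hle : Valued.v (κ + ρ κ) ≤ exp (-1 : ℤ) := by
    by_contra h
    exact hne (v_eq_one_of_exp_neg_one_lt hκρ1 (not_le.1 h))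
  have hbd : Valued.v ((κ + ρ κ) * (cc * (α - ρ α)) / ϖE) ≤ Valued.v (cc * (α - ρ α)) := by
    rw [map_div₀, Valuation.map_mul, hϖE, div_le_iff₀ exp_pos]
    calc Valued.v (κ + ρ κ) * Valued.v (cc * (α - ρ α)) ≤ exp (-1 : ℤ) * Valued.v (cc * (α - ρ α)) := by gcongr
      _ = Valued.v (cc * (α - ρ α)) * exp (-1 : ℤ) := mul_comm _ _
  rw [hdiff] at hlt
  exact absurd hlt (not_lt.2 hbd)

/-- **`Tr_ρ(z⁻¹) = Tr_ρ(z)∕(z·ρz)`**, hence `|Tr_ρ(z⁻¹)| = |Tr_ρ z|` for a unit `z` (`ρ` isometric). [cite: Serre1979, Ch. III §6 Prop. 12] -/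
theorem v_inv_add_map_inv_eq (hvρ : ∀ x, Valued.v (ρ x) = Valued.v x) {z : M} (hz1 : Valued.v z = 1) :
    Valued.v (z⁻¹ + ρ z⁻¹) = Valued.v (z + ρ z) := by
  have hz0 : z ≠ 0 := fun h0 => by rw [h0, map_zero] at hz1; exact zero_ne_one hz1
  have hρz0 : ρ z ≠ 0 := (map_ne_zero ρ).2 hz0
  have h1 : z⁻¹ + ρ z⁻¹ = (z + ρ z) / (z * ρ z) := by rw [map_inv₀]; field_simp; ring
  rw [h1, map_div₀, Valuation.map_mul, hvρ, hz1, mul_one, div_one]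

/-- **A NEAR-FIXED UNIT MULTIPLIER KEEPS THE TRACE A UNIT**: `|κ| ≤ 1`, `|κ + ρκ| = 1`, `ν = f₁ + π₁` with `ρf₁ = f₁`, `|f₁| = 1`, `|π₁| < 1` ⇒ `|νκ + ρ(νκ)| = 1`
(`νκ + ρ(νκ) = f₁(κ + ρκ) + (π₁κ + ρ(π₁κ))`, ultrametric). [cite: Serre1979, Ch. III §6 Prop. 12] -/
theorem v_mul_add_map_mul_eq_one (hvρ : ∀ x, Valued.v (ρ x) = Valued.v x) {κ f₁ π₁ : M} (hκ1 : Valued.v κ ≤ 1) (hκtr : Valued.v (κ + ρ κ) = 1)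
    (hρf₁ : ρ f₁ = f₁) (hf₁ : Valued.v f₁ = 1) (hπ₁ : Valued.v π₁ < 1) :
    Valued.v ((f₁ + π₁) * κ + ρ ((f₁ + π₁) * κ)) = 1 := by
  have hsplit : (f₁ + π₁) * κ + ρ ((f₁ + π₁) * κ) = f₁ * (κ + ρ κ) + (π₁ * κ + ρ (π₁ * κ)) := by
    rw [map_mul, map_add, hρf₁, map_mul]; ring
  have hmain : Valued.v (f₁ * (κ + ρ κ)) = 1 := by rw [Valuation.map_mul, hf₁, hκtr, one_mul]
  have hsmall : Valued.v (π₁ * κ + ρ (π₁ * κ)) < Valued.v (f₁ * (κ + ρ κ)) := by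
    rw [hmain]
    refine lt_of_le_of_lt (v_add_map_le_of_le ρ hvρ (le_refl _)) ?_
    rw [Valuation.map_mul]
    calc Valued.v π₁ * Valued.v κ ≤ Valued.v π₁ * 1 := by gcongr
      _ < 1 := by rw [mul_one]; exact hπ₁
  rw [hsplit, Valuation.map_add_eq_of_lt_left _ hsmall, hmain]

/-- **`(α − ρα)·Θ(α − ρα)` IS A `ρ`-FIXED UNIT MODULO `𝔭_M`** in the RamK line (`ρ`, `Θ` commuting isometric involutions, `|α − ρα| = 1`, the RamK case-definer `|α − Θα| < 1`):
`(α − ρα)Θ(α − ρα) = (α − ρα)² + π₁` with `ρ((α − ρα)²) = (α − ρα)²`, `|(α − ρα)²| = 1`, `|π₁| < 1`. [cite: Serre1979, Ch. III §6 Prop. 12] [cite: Jacobowitz1962, §4] -/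
theorem normTheta_sub_map_eq_sq_add (hρρ : ∀ x, ρ (ρ x) = x) (hvρ : ∀ x, Valued.v (ρ x) = Valued.v x) (hΘρ : ∀ x, Θ (ρ x) = ρ (Θ x))
    (hαρ1 : Valued.v (α - ρ α) = 1) (hram : Valued.v (α - Θ α) < 1) :
    ρ ((α - ρ α) * (α - ρ α)) = (α - ρ α) * (α - ρ α) ∧ Valued.v ((α - ρ α) * (α - ρ α)) = 1 ∧
      Valued.v ((α - ρ α) * Θ (α - ρ α) - (α - ρ α) * (α - ρ α)) < 1 := by
  refine ⟨by rw [map_mul, map_sub, hρρ]; ring, by rw [Valuation.map_mul, hαρ1, mul_one], ?_⟩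
  have h1 : (α - ρ α) * Θ (α - ρ α) - (α - ρ α) * (α - ρ α) = (α - ρ α) * (-(α - Θ α) + ρ (α - Θ α)) := by
    rw [map_sub, map_sub, hΘρ]; ring
  rw [h1, Valuation.map_mul, hαρ1, one_mul]
  refine lt_of_le_of_lt (Valuation.map_add _ _ _) (max_lt ?_ ?_)
  · rw [Valuation.map_neg]; exact hram
  · rw [hvρ]; exact hram

/-- **THE SCALAR IS A UNIT FOR `δ ≥ 1`.**  One-field RamK letters of ★ DEFS ∕ ★ T4 (`ρ`, `Θ` commuting isometric involutions, `Θh = h`, integral power basis `hα hα1 hint`,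
`jE(E) = Fix ρ`, `|α − ρα| = 1`, the RamK case-definer `|α − Θα| < 1`, a `ρ`-fixed uniformiser `ϖE`, a `ρ`-fixed conductor scalar `cc` with `|cc(α − ρα)| = |ϖE|^b`), a
member `Λ = x₀·𝒪_cc` of the DIAGONAL cell: level `|Y| = |ϖE|^b` (`Y = dualGen ρ Θ α cc h x₀`), Gram-primitive (`¬ IsOrd ρ α cc (Y∕ϖE)`), `1 ≤ b`; and a depth multiplier `μ` with
`|μ| = |ϖE|^{2b}` EXACTLY and eigenvalue gap `δ ≥ 1` (`|μ − ρμ| ≤ |ϖE^{2b+δ}(α − ρα)|`).  THEN `|Tr_ρ(μ∕D₀)| = 1`, `D₀ = cc(α − ρα)·ΘY`:  with `κ = h·x₀Θx₀` (`|κ| = 1`,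
`|κ + ρκ| = 1` by Gram-primitivity), `D₀ = ccΘcc·ν₁·κ`, `μ = ϖE^{2b}(jE e + ϖE^δ y)` (★ `exists_eq_pow_mul_map_add`), the leading term of `Tr_ρ(μ∕D₀)` is the `ρ`-fixed unit
`(ϖE^{2b}∕ccΘcc)·jE e` times `Tr_ρ((ν₁κ)⁻¹)`, a unit by `v_mul_add_map_mul_eq_one`; the tail is `O(ϖE^δ)`.  (At `δ = 0` this FAILS: the (L-EQ) cell has off-shell vertices.)
[cite: Jacobowitz1962, §4] [cite: Serre1979, Ch. III §6 Prop. 12] [cite: Kottwitz1986BaseChangeUnits, §1 pp. 240–241] -/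
theorem v_scalarTrace_eq_one_of_gap {E : Type} [Field E] (hρρ : ∀ x, ρ (ρ x) = x) (hvρ : ∀ x, Valued.v (ρ x) = Valued.v x)
    (hΘΘ : ∀ x, Θ (Θ x) = x) (hΘρ : ∀ x, Θ (ρ x) = ρ (Θ x)) (hvΘ : ∀ x, Valued.v (Θ x) = Valued.v x)
    (hα : ρ α ≠ α) (hα1 : Valued.v α ≤ 1) (hint : ∀ z : M, Valued.v z ≤ 1 → Valued.v ((z - ρ z) / (α - ρ α)) ≤ 1)
    (jE : E →+* M) (hjfix : ∀ z, ρ z = z ↔ ∃ c, jE c = z)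
    (hαρ1 : Valued.v (α - ρ α) = 1) (hram : Valued.v (α - Θ α) < 1)
    {ϖE : M} (hρϖ : ρ ϖE = ϖE) (hϖE : Valued.v ϖE = exp (-1 : ℤ))
    {h : M} (hΘh : Θ h = h) {cc : M} (hρcc : ρ cc = cc) {b : ℕ} (hccv : Valued.v (cc * (α - ρ α)) = Valued.v ϖE ^ b) (hb1 : 1 ≤ b)
    {x₀ : M} (hylev : Valued.v (dualGen ρ Θ α cc h x₀) = Valued.v ϖE ^ b)
    (hprim : ¬ IsOrd ρ α cc (dualGen ρ Θ α cc h x₀ / ϖE))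
    {μ : M} {δ : ℕ} (hm : Valued.v μ = Valued.v ϖE ^ (2 * b)) (hjl : Valued.v (μ - ρ μ) ≤ Valued.v (ϖE ^ (2 * b + δ) * (α - ρ α))) (hδ : 1 ≤ δ) :
    Valued.v (μ / (cc * (α - ρ α) * Θ (dualGen ρ Θ α cc h x₀)) + ρ (μ / (cc * (α - ρ α) * Θ (dualGen ρ Θ α cc h x₀)))) = 1 := by
  have hvϖ0 : Valued.v ϖE ≠ 0 := by rw [hϖE]; exact exp_ne_zero
  have hϖ0 : ϖE ≠ 0 := fun h0 => by rw [h0, map_zero] at hvϖ0; exact hvϖ0 rfl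
  have hϖ1 : Valued.v ϖE ≤ 1 := by rw [hϖE, ← exp_zero, exp_le_exp]; norm_num
  have hϖlt : Valued.v ϖE < 1 := by rw [hϖE, ← exp_zero, exp_lt_exp]; norm_num
  have hcc0 : cc * (α - ρ α) ≠ 0 := fun h0 => by
    rw [h0, map_zero] at hccv; exact pow_ne_zero _ hvϖ0 hccv.symm
  have hcc0' : cc ≠ 0 := fun h0 => hcc0 (by rw [h0, zero_mul])
  -- the letters `κ`, `ν₁`, `P`
  set κ : M := h * (x₀ * Θ x₀) with hκ
  set ν₁ : M := (α - ρ α) * Θ (α - ρ α) with hν₁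
  set P : M := cc * Θ cc with hP
  have hY : dualGen ρ Θ α cc h x₀ = κ * (cc * (α - ρ α)) := by rw [dualGen_def]
  have hκv : Valued.v κ = 1 := by
    have h1 := hylev
    rw [hY, Valuation.map_mul, hccv] at h1
    exact (mul_eq_right₀ (pow_ne_zero _ hvϖ0)).1 h1
  -- Gram-primitivity: `|κ + ρκ| = 1`
  have hY1 : Valued.v (κ * (cc * (α - ρ α)) / ϖE) ≤ 1 := by
    rw [map_div₀, Valuation.map_mul, hκv, one_mul, hccv, div_le_one₀ (zero_lt_iff.2 hvϖ0)]
    calc Valued.v ϖE ^ b ≤ Valued.v ϖE ^ 1 := pow_le_pow_right_of_le_one' hϖ1 hb1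
      _ = Valued.v ϖE := pow_one _
  have hκtr : Valued.v (κ + ρ κ) = 1 := by
    rw [hY] at hprim
    exact v_add_map_eq_one_of_not_isOrd_div hρρ hvρ hρcc hρϖ hcc0 hκv.le hϖE hY1 hprim
  -- `D₀ = P ν₁ κ`, `Θ`-algebra
  have hD₀ : cc * (α - ρ α) * Θ (dualGen ρ Θ α cc h x₀) = P * ν₁ * κ := by
    rw [hY, hκ, map_mul, map_mul, map_mul, map_mul, hΘh, hΘΘ, hP, hν₁]; ring
  have hν₁ := normTheta_sub_map_eq_sq_add (Θ := Θ) hρρ hvρ hΘρ hαρ1 hram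
  obtain ⟨hρf₁, hf₁, hπ₁⟩ := hν₁
  have hν₁v : Valued.v ν₁ = 1 := by rw [hν₁, Valuation.map_mul, hvΘ, hαρ1, mul_one]
  have hν₁0 : ν₁ ≠ 0 := fun h0 => by rw [h0, map_zero] at hν₁v; exact zero_ne_one hν₁v
  have hPv : Valued.v P = Valued.v ϖE ^ (2 * b) := by
    have hccv' : Valued.v cc = Valued.v ϖE ^ b := by rw [Valuation.map_mul, hαρ1, mul_one] at hccv; exact hccv
    rw [hP, Valuation.map_mul, hvΘ, hccv', ← pow_add, two_mul]
  have hP0 : P ≠ 0 := mul_ne_zero hcc0' ((map_ne_zero Θ).2 hcc0')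
  have hρP : ρ P = P := by rw [hP, map_mul, hρcc, ← hΘρ, hρcc]
  -- the unit trace `|Tr_ρ((ν₁κ)⁻¹)| = 1`
  have hνκ1 : Valued.v (ν₁ * κ) = 1 := by rw [Valuation.map_mul, hν₁v, hκv, mul_one]
  have htr1 : Valued.v ((ν₁ * κ)⁻¹ + ρ (ν₁ * κ)⁻¹) = 1 := by
    rw [v_inv_add_map_inv_eq hvρ hνκ1]
    have hsplit : ν₁ = (α - ρ α) * (α - ρ α) + ((α - ρ α) * Θ (α - ρ α) - (α - ρ α) * (α - ρ α)) := by rw [hν₁]; ring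
    rw [hsplit]
    exact v_mul_add_map_mul_eq_one hvρ hκv.le hκtr hρf₁ hf₁ hπ₁
  -- the E-approximant of `μ`
  obtain ⟨e, y, he1, hy1, hμey⟩ := exists_eq_pow_mul_map_add hρρ hα hα1 hint jE hjfix hρϖ hϖ0 hϖ1 hm.le hjl
  have hje1 : Valued.v (jE e) = 1 := by
    -- `|ϖE^{2b} jE e| = |μ − ϖE^{2b+δ} y| = |μ|` (the tail is strictly smaller)
    have htail : Valued.v (-(ϖE ^ (2 * b + δ) * y)) < Valued.v μ := by
      rw [Valuation.map_neg, Valuation.map_mul, Valuation.map_pow, hm]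
      calc Valued.v ϖE ^ (2 * b + δ) * Valued.v y ≤ Valued.v ϖE ^ (2 * b + δ) * 1 := by gcongr
        _ < Valued.v ϖE ^ (2 * b) := by
          rw [mul_one]; exact pow_lt_pow_right_of_lt_one₀ (zero_lt_iff.2 hvϖ0) hϖlt (by omega)
    have h2 : ϖE ^ (2 * b) * jE e = μ + -(ϖE ^ (2 * b + δ) * y) := by rw [hμey]; ring
    have h3 : Valued.v (ϖE ^ (2 * b) * jE e) = Valued.v ϖE ^ (2 * b) := by rw [h2, Valuation.map_add_eq_of_lt_left _ htail, hm]
    rw [Valuation.map_mul, Valuation.map_pow] at h3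
    exact (mul_eq_left₀ (pow_ne_zero _ hvϖ0)).1 h3
  have hρe : ρ (jE e) = jE e := (hjfix _).2 ⟨e, rfl⟩
  -- `μ / D₀ = c·jE e·(ν₁κ)⁻¹ + c·ϖE^δ·y·(ν₁κ)⁻¹`, `c = ϖE^{2b}/P`
  set c : M := ϖE ^ (2 * b) / P with hc
  have hcv : Valued.v c = 1 := by rw [hc, map_div₀, Valuation.map_pow, hPv, div_self (pow_ne_zero _ hvϖ0)]
  have hρc : ρ c = c := by rw [hc, map_div₀, map_pow, hρϖ, hρP]
  have hsplit : μ / (P * ν₁ * κ) = c * jE e * (ν₁ * κ)⁻¹ + c * ϖE ^ δ * y * (ν₁ * κ)⁻¹ := by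
    rw [hμey, hc]; field_simp; ring
  have hlead : c * jE e * (ν₁ * κ)⁻¹ + ρ (c * jE e * (ν₁ * κ)⁻¹) = c * jE e * ((ν₁ * κ)⁻¹ + ρ (ν₁ * κ)⁻¹) := by
    rw [map_mul, map_mul, hρc, hρe]; ring
  have hleadv : Valued.v (c * jE e * ((ν₁ * κ)⁻¹ + ρ (ν₁ * κ)⁻¹)) = 1 := by
    rw [Valuation.map_mul, Valuation.map_mul, hcv, hje1, htr1, one_mul, one_mul]
  have htailv : Valued.v (c * ϖE ^ δ * y * (ν₁ * κ)⁻¹ + ρ (c * ϖE ^ δ * y * (ν₁ * κ)⁻¹)) < 1 := by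
    refine lt_of_le_of_lt (v_add_map_le_of_le ρ hvρ (le_refl _)) ?_
    rw [Valuation.map_mul, Valuation.map_mul, Valuation.map_mul, map_inv₀, hcv, hνκ1, Valuation.map_pow, one_mul, inv_one, mul_one]
    calc Valued.v ϖE ^ δ * Valued.v y ≤ Valued.v ϖE ^ δ * 1 := by gcongr
      _ < 1 := by rw [mul_one]; exact pow_lt_one₀ zero_le hϖlt (by omega)
  rw [hD₀, hsplit, map_add ρ]
  have hrearr : c * jE e * (ν₁ * κ)⁻¹ + c * ϖE ^ δ * y * (ν₁ * κ)⁻¹ + (ρ (c * jE e * (ν₁ * κ)⁻¹) + ρ (c * ϖE ^ δ * y * (ν₁ * κ)⁻¹)) =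
      c * jE e * ((ν₁ * κ)⁻¹ + ρ (ν₁ * κ)⁻¹) + (c * ϖE ^ δ * y * (ν₁ * κ)⁻¹ + ρ (c * ϖE ^ δ * y * (ν₁ * κ)⁻¹)) := by
    rw [← hlead]; ring
  rw [hrearr, ← hleadv]
  exact Valuation.map_add_eq_of_lt_left _ (by rw [hleadv]; exact htailv)

end Unit

/-! ## §3 HEAD′ — the scalar and its fixed unit exist for `δ ≥ 1` -/

section Assembled

variable {E M : Type} [Field E] [Valued E ℤᵐ⁰] [Field M] [Valued M ℤᵐ⁰] {ρ Θ : M →+* M} {α : M}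

/-- **HEAD′ — THE SCALAR AND ITS FIXED UNIT EXIST FOR `δ ≥ 1` (one-field letters, no lattice).**  E-side: a sheet datum `IsRamifiedQuadraticDatum σ ϖ d t` with `d` EVEN; M-side:
★ T4's line letters (`ρ`, `Θ` commuting isometric involutions, `Θ ∘ jE = jE ∘ σ`, `jE(E) = Fix ρ`, `|jE c| ≤ 1 ↔ |c| ≤ 1`, `|jEϖ| = exp(−1)`, integral power basis `hα hα1 hint`,
`|α − ρα| = 1`, the RamK case-definer `|α − Θα| < 1`, `Θh_M = h_M`); the torus equations `Θ(lam)·lam = 1`, `|lam| = 1`, `u·σu = 1`, `|u − 1| ≤ |ϖ|^{m*}`; the D-cell member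
letters (`ρcc = cc`, `|cc(α − ρα)| = |jEϖ|^b`, level `|Y| = |jEϖ|^b`, Gram-primitive `¬ IsOrd ρ α cc (Y∕jEϖ)`); the (R-sp) depths `|μ| = |jEϖ|^{2b}`, `|μ − ρμ| ≤ |jEϖ^{2b+δ}(α − ρα)|`
with `1 ≤ δ`, and the regime `3d − 2 ≤ 2b`.  THEN there are `s f : E` with `jE s = Tr_ρ(μ∕D₀)`, `|s| = 1`, `|s + σs| ≤ |ϖ|^{3d−2}`, `σf = f`, `|f| = 1`, `|s − f·t₊| ≤ |ϖ|^{m*}`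
(§1 ⊕ §2 ⊕ ★ p861813 §1) — the `(s, f)` the sibling HEAD′ `F0P3cDyRamDiagonalCellLetterBalanced.valueSet_endoGL_sub_one_glued_eq_smul_xPlus_of_diag_of_scalar` consumes at
`m = m*`; by ★ p861154 the vertex then carries label `+` iff `f ∈ N(E^×)`.
[cite: Serre1979, Ch. I §6 Prop. 18] [cite: Serre1979, Ch. III §3 Prop. 7] [cite: Jacobowitz1962, §4] [cite: Rogawski1990, §4.9 Prop. 4.9.1 (b) p. 55] [cite: LanglandsShelstad1987, §1–§3] -/
theorem exists_scalar_fixed_unit_of_diag_of_gap {σ : E →+* E} {ϖ : E} {d t : ℕ} (hD : IsRamifiedQuadraticDatum σ ϖ d t) (hd2 : d % 2 = 0)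
    (hρρ : ∀ x, ρ (ρ x) = x) (hvρ : ∀ x, Valued.v (ρ x) = Valued.v x) (hΘΘ : ∀ x, Θ (Θ x) = x) (hΘρ : ∀ x, Θ (ρ x) = ρ (Θ x))
    (hvΘ : ∀ x, Valued.v (Θ x) = Valued.v x)
    (hα : ρ α ≠ α) (hα1 : Valued.v α ≤ 1) (hint : ∀ z : M, Valued.v z ≤ 1 → Valued.v ((z - ρ z) / (α - ρ α)) ≤ 1)
    (jE : E →+* M) (hjv : ∀ c, Valued.v (jE c) ≤ 1 ↔ Valued.v c ≤ 1) (hjfix : ∀ z, ρ z = z ↔ ∃ c, jE c = z)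
    (hΘj : ∀ c, Θ (jE c) = jE (σ c)) (hjϖ : Valued.v (jE ϖ) = exp (-1 : ℤ))
    (hαρ1 : Valued.v (α - ρ α) = 1) (hram : Valued.v (α - Θ α) < 1)
    {lam hM : M} (hΘh : Θ hM = hM) (hhM : hM ≠ 0) (hΘlam : Θ lam * lam = 1) (hlam1 : Valued.v lam = 1)
    {u : E} (huu : u * σ u = 1) (hu1 : Valued.v (u - 1) ≤ Valued.v ϖ ^ mstarOfRecord d)
    {cc x₀ : M} {b : ℕ} (hρcc : ρ cc = cc) (hccv : Valued.v (cc * (α - ρ α)) = Valued.v (jE ϖ) ^ b) (hx₀ : x₀ ≠ 0)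
    (hylev : Valued.v (dualGen ρ Θ α cc hM x₀) = Valued.v (jE ϖ) ^ b) (hprim : ¬ IsOrd ρ α cc (dualGen ρ Θ α cc hM x₀ / jE ϖ))
    {δ : ℕ} (hm : Valued.v (lam - jE u) = Valued.v (jE ϖ) ^ (2 * b))
    (hjl : Valued.v ((lam - jE u) - ρ (lam - jE u)) ≤ Valued.v (jE ϖ ^ (2 * b + δ) * (α - ρ α))) (hδ : 1 ≤ δ) (hb : 3 * d - 2 ≤ 2 * b) :
    ∃ s f : E, jE s = (lam - jE u) / (cc * (α - ρ α) * Θ (dualGen ρ Θ α cc hM x₀)) + ρ ((lam - jE u) / (cc * (α - ρ α) * Θ (dualGen ρ Θ α cc hM x₀))) ∧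
      Valued.v s = 1 ∧ Valued.v (s + σ s) ≤ Valued.v ϖ ^ (3 * d - 2) ∧ σ f = f ∧ Valued.v f = 1 ∧
      Valued.v (s - f * ((ϖ - σ ϖ) * ((ϖ * σ ϖ) ^ ((d - d % 2) / 2))⁻¹)) ≤ Valued.v ϖ ^ mstarOfRecord d := by
  obtain ⟨hσσ, hvσ, hϖ, hfix, hdd, hd1, ht⟩ := hD
  have hvϖ0 : Valued.v ϖ ≠ 0 := by rw [hϖ]; exact exp_ne_zero
  have hϖ0 : ϖ ≠ 0 := fun h0 => by rw [h0, map_zero] at hvϖ0; exact hvϖ0 rfl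
  have hjvϖ0 : Valued.v (jE ϖ) ≠ 0 := by rw [hjϖ]; exact exp_ne_zero
  have hρϖ : ρ (jE ϖ) = jE ϖ := (hjfix _).2 ⟨ϖ, rfl⟩
  have hb1 : 1 ≤ b := by omega
  have hcc : cc * (α - ρ α) ≠ 0 := fun h0 => by rw [h0, map_zero] at hccv; exact pow_ne_zero _ hjvϖ0 hccv.symm
  set Y : M := dualGen ρ Θ α cc hM x₀ with hYdef
  set D₀ : M := cc * (α - ρ α) * Θ Y with hD₀def
  set μ : M := lam - jE u with hμdef
  have hY0 : Y ≠ 0 := by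
    rw [hYdef, dualGen_def]; exact mul_ne_zero (mul_ne_zero hhM (mul_ne_zero hx₀ ((map_ne_zero Θ).2 hx₀))) hcc
  have hD₀0 : D₀ ≠ 0 := mul_ne_zero hcc ((map_ne_zero Θ).2 hY0)
  have hD₀v : Valued.v D₀ = Valued.v (jE ϖ) ^ (2 * b) := by rw [hD₀def, Valuation.map_mul, hvΘ, hccv, hylev, two_mul, pow_add]
  have hΘD₀ : Θ D₀ = D₀ := by
    rw [hD₀def, hYdef, dualGen_def]
    simp only [map_mul, hΘΘ, hΘh]
    ring
  have hρS : ρ (μ / D₀ + ρ (μ / D₀)) = μ / D₀ + ρ (μ / D₀) := by rw [map_add, hρρ, add_comm]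
  obtain ⟨s, hs⟩ := (hjfix _).1 hρS
  have hS1 : Valued.v (μ / D₀ + ρ (μ / D₀)) = 1 :=
    v_scalarTrace_eq_one_of_gap hρρ hvρ hΘΘ hΘρ hvΘ hα hα1 hint jE hjfix hαρ1 hram hρϖ hjϖ hΘh hρcc hccv hb1 hylev hprim hm hjl hδ
  have hs1 : Valued.v s = 1 := by
    have h1 := v_eq_pow_of_map_eq jE hjv hϖ0 (c := s) (n := 0) (by rw [pow_zero, hs, hS1])
    rwa [pow_zero] at h1
  have h2 : Valued.v (2 : E) ≤ Valued.v ϖ ^ (d - 1) := by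
    rw [ht]; exact v_varpi_pow_le_pow hϖ (by have := d_le_succ_t hσσ hfix hϖ hdd ht; omega)
  have hstr : Valued.v (s + σ s) ≤ Valued.v ϖ ^ (3 * d - 2) :=
    v_scalar_add_map_le_of_torus σ hvσ hϖ jE hjv hvρ hΘρ hvΘ hΘj h2 hΘlam hlam1 huu hu1 hΘD₀ hD₀v hD₀0 hm.le hb hs
  obtain ⟨f, hσf, hf1, hsf⟩ := exists_fixed_unit_sub_mul_refSkew_le ⟨hσσ, hvσ, hϖ, hfix, hdd, hd1, ht⟩ hd2 hs1 hstr
  exact ⟨s, f, hs, hs1, hstr, hσf, hf1, hsf⟩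

end Assembled


end Summit.HodgeConjecture.HodgeConjecture.Cruxes.H413.F0P3cDyRamDiagonalCellScalarUnit

end
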